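import Summits.Ventures.HodgeRepro.Night4RouteC
import Mathlib

/-!
# Route C with its conditionality (O-R2.3) in the theorem signature — BMM Cor 2 AS PRINTED

Blind re-derivation cell `pub-hodge-repro`, seat `night-4` (ROUTE HARDENING for the Monday FINAL, gen 1).  Target tree path
`lean/Summits/Ventures/HodgeRepro/Night4RouteCConditional.lean`.

`Night4RouteC.lean` states Route C's closing row `S0 ⇐ BMM_Cor2 ∧ R7 ∧ …` with the conditionality of BMM Cor 2 (ROUTE.md
R2.3 = O-R2.3) carried ONLY in the docstring of `BMM_Cor2` (night-4 g0's finding (b): "O-R2.3 is not a Prop of this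
interface").  For the DEMO-PACKET's sentence "every hypothesis verbatim and machine-checked as a statement" this file
makes the condition VISIBLE in the signatures: the interface is extended by ONE abstract proposition
`TwistedStabilization` — the condition exactly as Bergeron–Millson–Mœglin print it in their abstract —, BMM Cor 2 is typed
AS PRINTED, i.e. as the implication `TwistedStabilization → BMM_Cor2` (`BMM_Cor2_asPrinted`), and Route C's closing row
becomes `S0 ⇐ TwistedStabilization ∧ BMM_Cor2_asPrinted ∧ R7 ∧ …` (`S0_of_routeC_conditional`,
`S0_of_routeC_conditional_printed`).  The field is an ABSTRACT proposition of the interface (like `IsCompactBallQuotient`):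
it is never defined, never proved and never assumed true by any theorem of the cell; it is consumed as a hypothesis.

HONESTY.  Nothing mathematical is proved; the theorems are the logical compositions of `Night4RouteC.lean` with the
conditionality made explicit.  Nothing here says anything about the status of the Hodge conjecture for CM abelian
varieties, which is NOT proved.
-/

set_option autoImplicit false

namespace HodgeRepro.Route

/-- **The interface of Route C with its printed condition**: the data of `Night4RouteC.lean` (`R7Data`: varieties,
cohomology, Hodge and algebraic classes, dimension, compact ball quotients, surjections, cup product, push-forward)
together with ONE abstract proposition — the condition under which Bergeron–Millson–Mœglin's results are proved, as
printed in their abstract (store `paper:arxiv-1306.1515` p0002:L7–9, re-read by the seat 2026-08-24): "The proofs make use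
of the recent endoscopic classification of automorphic representations of classical groups by [ArthurBook,Mok]. As such
our results are conditional on the stabilization of the trace formula for the (disconnected) groups GL(N) ⋊ ⟨θ⟩
associated to base change. At present the stabilization of the trace formula has been proved only for the case of
connected groups. But the extension needed is now announced, see (org2) for more details."  The cell's reading of the
residual (ROUTE.md O-R2.3, SOURCES row COND-WFL): the condition is itself in print (Mœglin–Waldspurger, *Stabilisation de
la formule des traces tordue X*, arXiv:1412.2981), its residual «trou» the weighted fundamental lemma for nonsplit groups
and its nonstandard version (Shin 2024 (H1); AGIKMS 2024 preprint); nothing of that is typed — the field stands for the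
printed sentence only. -/
structure RouteCCondData extends R7Data where
  /-- "the stabilization of the trace formula for the (disconnected) groups `GL(N) ⋊ ⟨θ⟩` associated to base change"
  (BMM 2016, abstract, store p0002:L8–9) — the printed condition of BMM's results; an abstract proposition -/
  TwistedStabilization : Prop

variable (𝓒 : RouteCCondData)

/-- **BMM Cor 2 AS PRINTED** — the corollary (store p0003:L65–67: "Let S be a connected compact Shimura variety associated
to the unitary group U(p,1) and let n ∈ [0,p] ∖ ]p/3, 2p/3[. Then every Hodge class in H^{2n}(S,ℚ) is algebraic.")
under the condition of the abstract (p0002:L8–9): `TwistedStabilization → BMM_Cor2`.  PRINTED (the implication is what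
the paper proves; `Route.BMM_Cor2` alone is its PRINTED-CONDITIONAL conclusion). -/
def BMM_Cor2_asPrinted : Prop :=
  𝓒.TwistedStabilization → BMM_Cor2 𝓒.toRouteCData

/-- The conclusion of BMM Cor 2 follows from its printed form once the condition is granted. -/
theorem BMM_Cor2_of_asPrinted (hstab : 𝓒.TwistedStabilization) (h : BMM_Cor2_asPrinted 𝓒) :
    BMM_Cor2 𝓒.toRouteCData :=
  h hstab

/-- **Route C's closing row with the conditionality explicit**: `S0 ⇐ TwistedStabilization ∧ BMM_Cor2_asPrinted ∧ R7_codim ∧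
ExistsDominantBallQuotient ∧ LefschetzSymmetry ∧ VanishAboveDim` — `Night4RouteC.S0_of_routeC` with `BMM_Cor2` replaced by
its printed form and the condition it carries. -/
theorem S0_of_routeC_conditional (hstab : 𝓒.TwistedStabilization) (hBMM : BMM_Cor2_asPrinted 𝓒)
    (hR7 : R7_codim 𝓒.toRouteCData) (hDom : ExistsDominantBallQuotient 𝓒.toRouteCData)
    (hLef : LefschetzSymmetry 𝓒.toRouteCData) (hvan : VanishAboveDim 𝓒.toRouteCData) : S0 𝓒.toRouteData :=
  S0_of_routeC 𝓒.toRouteCData (hBMM hstab) hR7 hDom hLef hvan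

/-- **Route C's closing row, every hypothesis printed and the conditionality explicit**: `S0 ⇐ TwistedStabilization ∧
BMM_Cor2_asPrinted ∧ HodgePull ∧ AlgCup ∧ AlgPush ∧ ProjectionSection ∧ ExistsDominantBallQuotient ∧ LefschetzSymmetry ∧
VanishAboveDim` — `Night4RouteC.S0_of_routeC_printed` with `BMM_Cor2` replaced by its printed form; the one remaining
non-printed content is inside `ExistsDominantBallQuotient` (R5 / Lemma W, the cell's elementary lemma). -/
theorem S0_of_routeC_conditional_printed (hstab : 𝓒.TwistedStabilization) (hBMM : BMM_Cor2_asPrinted 𝓒)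
    (hHP : HodgePull 𝓒.toR7Data) (hCup : AlgCup 𝓒.toR7Data) (hPush : AlgPush 𝓒.toR7Data)
    (hPS : ProjectionSection 𝓒.toR7Data) (hDom : ExistsDominantBallQuotient 𝓒.toRouteCData)
    (hLef : LefschetzSymmetry 𝓒.toRouteCData) (hvan : VanishAboveDim 𝓒.toRouteCData) : S0 𝓒.toRouteData :=
  S0_of_routeC_printed 𝓒.toR7Data (hBMM hstab) hHP hCup hPush hPS hDom hLef hvan

/-- **Without the condition, Route C gives S0 only conditionally** — the honest reading of ROUTE.md §1 row S4ᶜ ("so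
Route C's conditional content is R6 = BMM Cor 2 ALONE"): from the printed inputs alone one obtains
`TwistedStabilization → S0`. -/
theorem routeC_implication (hBMM : BMM_Cor2_asPrinted 𝓒) (hHP : HodgePull 𝓒.toR7Data) (hCup : AlgCup 𝓒.toR7Data)
    (hPush : AlgPush 𝓒.toR7Data) (hPS : ProjectionSection 𝓒.toR7Data)
    (hDom : ExistsDominantBallQuotient 𝓒.toRouteCData) (hLef : LefschetzSymmetry 𝓒.toRouteCData)
    (hvan : VanishAboveDim 𝓒.toRouteCData) : 𝓒.TwistedStabilization → S0 𝓒.toRouteData :=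
  fun hstab => S0_of_routeC_conditional_printed 𝓒 hstab hBMM hHP hCup hPush hPS hDom hLef hvan

end HodgeRepro.Route
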